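import Summits.MatrixMultiplication.MatrixMultiplication.Theorems.ThinPackings.Negative.ThinPackingsPacking

/-!
# Regimes of the crux matrix of `ThinBlockAlpha.ThinPackings` (crux stmt-MatrixMultiplication-10595), III

* TRUE REGION `a < η` (tightness of `no_single_thin_block`, which kills `η < a` for one block):
  one block `ℤ/N × 0 × 0, 0 × 0 × ℤ/M, 0 × ℤ/N × 0` in `(ℤ/N)² × ℤ/M` with `N = ⌈2^{1/(η−a)}⌉`,
  `M = ⌈N^a⌉ ≤ N^η` is a witness of the `(a, η)` slice.  So the content of the crux is the
  triangle `0 < η < a < 1` (and, by the square ⇔ thin equivalence, only `η` matters there).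
* HOST-SIZE CAP AT BOUNDED EXPONENT (the strong, `L`-sensitive Theorem B of the tree,
  `AddSimultaneousTPP.exists_sum_rpow_le`: exponent `≤ ℓ ⇒ Σ vol^{2/3} ≤ |H|^{1−δ_ℓ}`): a thin
  near-tight family at `(a, η)` in a group of exponent `≤ ℓ` has `|H|^{δ_ℓ} ≤ N^{(2−2a)/3+η}`
  (the host is POLYNOMIAL in the block size — "astronomically many tiny blocks" is not a free
  regime) and `(2 + a)·δ_ℓ ≤ (2 − 2a)/3 + η` (how fast the exponent must grow as `a → 1`,
  `η → 0`; sharpens `not_thinPackingsBoundedExponent`).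
-/

namespace Summit.MatrixMultiplication.MatrixMultiplication.Theorems.ThinPackings.Negative

open Literature.Computability.AlgebraicComplexity Finset

/-! ## The single split block and the true region `a < η` -/

/-- TIGHTNESS of the single-block volume bound `N·M·N ≤ |H|`: for all `N, M ≥ 1` the block
`A = ℤ/N × 0 × 0`, `B = 0 × 0 × ℤ/M`, `C = 0 × ℤ/N × 0` is an STPP (= TPP) triple `⟨N, M, N⟩`
in `H = (ℤ/N)² × ℤ/M` with `|H| = N²M` exactly (a split/coset design).
[small model, tightness; folklore] -/
theorem single_block_volume_tight (N M : ℕ) [NeZero N] [NeZero M] :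
    ∃ (A B C : Fin 1 → Finset (ZMod N × ZMod N × ZMod M)), IsSTPP A B C ∧
      (∀ i, (A i).card = N ∧ (B i).card = M ∧ (C i).card = N) ∧
      Fintype.card (ZMod N × ZMod N × ZMod M) = N * M * N := by
  refine ⟨fun _ => univ.image fun x : ZMod N => ((x, 0, 0) : ZMod N × ZMod N × ZMod M),
    fun _ => univ.image fun z : ZMod M => ((0, 0, z) : ZMod N × ZMod N × ZMod M),
    fun _ => univ.image fun y : ZMod N => ((0, y, 0) : ZMod N × ZMod N × ZMod M), ?_,
    fun i => ?_, ?_⟩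
  · intro i j k s hs s' hs' t ht t' ht' u hu u' hu' h0
    simp only [mem_image, mem_univ, true_and] at hs hs' ht ht' hu hu'
    obtain ⟨x, rfl⟩ := hs; obtain ⟨x', rfl⟩ := hs'
    obtain ⟨z, rfl⟩ := ht; obtain ⟨z', rfl⟩ := ht'
    obtain ⟨y, rfl⟩ := hu; obtain ⟨y', rfl⟩ := hu'
    simp only [Prod.mk_sub_mk, Prod.mk_add_mk, sub_zero, add_zero, zero_add, Prod.mk_eq_zero,
      sub_eq_zero] at h0
    obtain ⟨h1, h2, h3⟩ := h0
    exact ⟨Subsingleton.elim _ _, Subsingleton.elim _ _, by rw [h1], by rw [h3], by rw [h2]⟩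
  · refine ⟨?_, ?_, ?_⟩ <;>
      rw [card_image_of_injective _ (by intro a b h; simpa using h), card_univ, ZMod.card]
  · simp only [Fintype.card_prod, ZMod.card]; ring

/-- **The true region.**  Every slice `(a, η)` with `0 ≤ a < η` of the crux matrix holds, by one
split block `⟨N, ⌈N^a⌉, N⟩` in `(ℤ/N)² × ℤ/⌈N^a⌉`, `N = ⌈2^{1/(η−a)}⌉` (so `N^a + 1 ≤ N^η`).
Together with `no_single_thin_block` (`η < a` fails for one block): single blocks serve exactly
the trivial exponent.  [small model, tightness; new] -/
theorem thin_slice_of_lt {a η : ℝ} (ha : 0 ≤ a) (haη : a < η) :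
    ∃ (H : Type) (_ : AddCommGroup H) (_ : Fintype H) (L N M : ℕ) (A B C : Fin L → Finset H),
      IsSTPP A B C ∧ (∀ i, (A i).card = N ∧ (B i).card = M ∧ (C i).card = N) ∧ 2 ≤ N ∧
      (N : ℝ) ^ a ≤ M ∧ (Fintype.card H : ℝ) ≤ L * (N : ℝ) ^ (2 + η) := by
  have hgap : 0 < η - a := by linarith
  set N : ℕ := ⌈(2 : ℝ) ^ (1 / (η - a))⌉₊ with hN
  have h2pow : (1 : ℝ) < (2 : ℝ) ^ (1 / (η - a)) := Real.one_lt_rpow (by norm_num) (by positivity)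
  have hNreal : (2 : ℝ) ^ (1 / (η - a)) ≤ N := Nat.le_ceil _
  have hN2 : 2 ≤ N := by
    have h1 : (1 : ℝ) < N := h2pow.trans_le hNreal
    have h2 : 1 < N := by exact_mod_cast h1
    omega
  have hNpos : (0 : ℝ) < N := by exact_mod_cast (by omega : 0 < N)
  have hN1 : (1 : ℝ) ≤ N := by exact_mod_cast (by omega : 1 ≤ N)
  set M : ℕ := ⌈(N : ℝ) ^ a⌉₊ with hM
  have hMge : (N : ℝ) ^ a ≤ M := Nat.le_ceil _
  have hNa1 : (1 : ℝ) ≤ (N : ℝ) ^ a := Real.one_le_rpow hN1 ha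
  have hM1 : 1 ≤ M := by
    have : (1 : ℝ) ≤ M := hNa1.trans hMge
    exact_mod_cast this
  haveI : NeZero N := ⟨by omega⟩
  haveI : NeZero M := ⟨by omega⟩
  obtain ⟨A, B, C, hS, hc, hcard⟩ := single_block_volume_tight N M
  refine ⟨ZMod N × ZMod N × ZMod M, inferInstance, inferInstance, 1, N, M, A, B, C, hS, hc, hN2,
    hMge, ?_⟩
  -- `M ≤ N^η`, since `N^η = N^a · N^{η−a} ≥ 2 N^a ≥ N^a + 1 > M`
  have hMle : (M : ℝ) ≤ (N : ℝ) ^ η := by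
    have hM' : (M : ℝ) < (N : ℝ) ^ a + 1 := Nat.ceil_lt_add_one (by positivity)
    have hNηa : (2 : ℝ) ≤ (N : ℝ) ^ (η - a) := by
      calc (2 : ℝ) = ((2 : ℝ) ^ (1 / (η - a))) ^ (η - a) := by
            rw [← Real.rpow_mul (by norm_num), one_div, inv_mul_cancel₀ hgap.ne', Real.rpow_one]
        _ ≤ (N : ℝ) ^ (η - a) := Real.rpow_le_rpow (by positivity) hNreal hgap.le
    have hsplit : (N : ℝ) ^ η = (N : ℝ) ^ a * (N : ℝ) ^ (η - a) := by
      rw [← Real.rpow_add hNpos]; congr 1; ring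
    rw [hsplit]
    nlinarith
  have hfin : ((N * M * N : ℕ) : ℝ) ≤ ((1 : ℕ) : ℝ) * (N : ℝ) ^ (2 + η) := by
    push_cast
    calc (N : ℝ) * M * N = (N * N) * M := by ring
      _ ≤ (N * N) * (N : ℝ) ^ η := by gcongr
      _ = 1 * (N : ℝ) ^ (2 + η) := by rw [Real.rpow_add hNpos, Real.rpow_two]; ring
  rw [hcard]
  exact hfin

/-! ## Bounded exponent: the host-size cap (strong Theorem B) -/

/-- **Host-size cap at exponent `ℓ`.**  With the `δ = δ_ℓ > 0` of the tree's strong Theorem B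
(`AddSimultaneousTPP.exists_sum_rpow_le`: `Σᵢ (|Aᵢ||Bᵢ||Cᵢ|)^{2/3} ≤ |H|^{1−δ}` at exponent `≤ ℓ`),
every thin near-tight family at `(a, η)` in a group of exponent `≤ ℓ` satisfies
`|H|^δ ≤ N^{(2−2a)/3+η}` and `(2 + a)·δ ≤ (2 − 2a)/3 + η`.  Proof:
`L (N²M)^{2/3} ≤ |H|^{1−δ}` and `|H| ≤ L N^{2+η}` give `|H|^δ N^{(2+a)2/3} ≤ N^{2+η}`; and
`|H| ≥ N²M ≥ N^{2+a}`.  [new; cite: BlasiakChurchCohnGrochowNaslundSawinUmans2017, Thm. B, §3.2] -/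
theorem host_cap_of_exponent_le (ℓ : ℕ) : ∃ δ : ℝ, 0 < δ ∧
    ∀ (H : Type) [AddCommGroup H] [Fintype H], AddMonoid.exponent H ≤ ℓ →
      ∀ (L N M : ℕ) (A B C : Fin L → Finset H) (a η : ℝ), IsSTPP A B C →
        (∀ i, (A i).card = N ∧ (B i).card = M ∧ (C i).card = N) → 2 ≤ N → 0 ≤ a →
        (N : ℝ) ^ a ≤ M → (Fintype.card H : ℝ) ≤ L * (N : ℝ) ^ (2 + η) →
        (Fintype.card H : ℝ) ^ δ ≤ (N : ℝ) ^ ((2 - 2 * a) / 3 + η) ∧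
        (2 + a) * δ ≤ (2 - 2 * a) / 3 + η := by
  obtain ⟨δ, hδ, hmain⟩ := Literature.Combinatorics.Additive.AddSimultaneousTPP.exists_sum_rpow_le ℓ
  refine ⟨δ, hδ, ?_⟩
  intro H _ _ hexp L N M A B C a η hS hc hN ha hM hH
  classical
  have hS' := (isSTPP_iff_addSimultaneousTPP A B C).1 hS
  have h := hmain H hexp (Fin L) A B C hS'
  have hsum : ∑ i : Fin L, (((A i).card * (B i).card * (C i).card : ℕ) : ℝ) ^ ((2 : ℝ) / 3) =
      L * (((N * M * N : ℕ) : ℝ) ^ ((2 : ℝ) / 3)) := by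
    rw [Finset.sum_congr rfl fun i _ => by rw [(hc i).1, (hc i).2.1, (hc i).2.2], sum_const,
      card_univ, Fintype.card_fin, nsmul_eq_mul]
  rw [hsum] at h
  have hL := one_le_L hH
  have hLpos : (0 : ℝ) < L := by exact_mod_cast (by omega : 0 < L)
  have hN1 : (1 : ℝ) < N := by exact_mod_cast (by omega : 1 < N)
  have hNpos : (0 : ℝ) < N := by linarith
  have hHpos : (0 : ℝ) < Fintype.card H := by exact_mod_cast Fintype.card_pos
  have hvol : (N : ℝ) ^ (2 + a) ≤ ((N * M * N : ℕ) : ℝ) := by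
    rw [Real.rpow_add hNpos, Real.rpow_two]
    push_cast
    calc (N : ℝ) ^ 2 * (N : ℝ) ^ a ≤ (N : ℝ) ^ 2 * (M : ℝ) := by gcongr
      _ = (N : ℝ) * M * N := by ring
  have hkey : (Fintype.card H : ℝ) * (N : ℝ) ^ ((2 + a) * ((2 : ℝ) / 3)) ≤
      (Fintype.card H : ℝ) ^ (1 - δ) * (N : ℝ) ^ (2 + η) := by
    calc (Fintype.card H : ℝ) * (N : ℝ) ^ ((2 + a) * ((2 : ℝ) / 3))
        ≤ (L * (N : ℝ) ^ (2 + η)) * (N : ℝ) ^ ((2 + a) * ((2 : ℝ) / 3)) := by gcongr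
      _ = (L * (N : ℝ) ^ ((2 + a) * ((2 : ℝ) / 3))) * (N : ℝ) ^ (2 + η) := by ring
      _ ≤ (L * ((N * M * N : ℕ) : ℝ) ^ ((2 : ℝ) / 3)) * (N : ℝ) ^ (2 + η) := by
          gcongr
          rw [Real.rpow_mul hNpos.le]
          exact Real.rpow_le_rpow (by positivity) hvol (by norm_num)
      _ ≤ (Fintype.card H : ℝ) ^ (1 - δ) * (N : ℝ) ^ (2 + η) := by gcongr
  have hmul : (Fintype.card H : ℝ) ^ (1 - δ) * (Fintype.card H : ℝ) ^ δ = Fintype.card H := by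
    rw [← Real.rpow_add hHpos]; simp
  have h1δ : (0 : ℝ) < (Fintype.card H : ℝ) ^ (1 - δ) := Real.rpow_pos_of_pos hHpos _
  have h2 : (Fintype.card H : ℝ) ^ δ * (N : ℝ) ^ ((2 + a) * ((2 : ℝ) / 3)) ≤
      (N : ℝ) ^ (2 + η) := by
    refine le_of_mul_le_mul_left ?_ h1δ
    calc (Fintype.card H : ℝ) ^ (1 - δ) *
          ((Fintype.card H : ℝ) ^ δ * (N : ℝ) ^ ((2 + a) * ((2 : ℝ) / 3)))
        = Fintype.card H * (N : ℝ) ^ ((2 + a) * ((2 : ℝ) / 3)) := by rw [← mul_assoc, hmul]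
      _ ≤ (Fintype.card H : ℝ) ^ (1 - δ) * (N : ℝ) ^ (2 + η) := hkey
  have h3 : (Fintype.card H : ℝ) ^ δ ≤ (N : ℝ) ^ ((2 - 2 * a) / 3 + η) := by
    have hNe : (0 : ℝ) < (N : ℝ) ^ ((2 + a) * ((2 : ℝ) / 3)) := Real.rpow_pos_of_pos hNpos _
    have h5 : (Fintype.card H : ℝ) ^ δ ≤ (N : ℝ) ^ (2 + η) / (N : ℝ) ^ ((2 + a) * ((2 : ℝ) / 3)) :=
      (le_div_iff₀ hNe).2 h2
    rw [← Real.rpow_sub hNpos] at h5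
    refine h5.trans (le_of_eq ?_)
    congr 1; ring
  refine ⟨h3, ?_⟩
  have hvolH : (N : ℝ) ^ (2 + a) ≤ Fintype.card H := by
    have h6 := thin_volume_bound hS hc ⟨0, hL⟩
    calc (N : ℝ) ^ (2 + a) ≤ ((N * M * N : ℕ) : ℝ) := hvol
      _ ≤ Fintype.card H := by exact_mod_cast h6
  have h4 : (N : ℝ) ^ ((2 + a) * δ) ≤ (N : ℝ) ^ ((2 - 2 * a) / 3 + η) := by
    calc (N : ℝ) ^ ((2 + a) * δ) = ((N : ℝ) ^ (2 + a)) ^ δ := Real.rpow_mul hNpos.le _ _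
      _ ≤ (Fintype.card H : ℝ) ^ δ := Real.rpow_le_rpow (by positivity) hvolH hδ.le
      _ ≤ _ := h3
  exact (Real.rpow_le_rpow_left_iff hN1).1 h4

end Summit.MatrixMultiplication.MatrixMultiplication.Theorems.ThinPackings.Negative
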